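import Mathlib.Tactic

/-!
# STUB-IDEAS k1 (gen 16) for `stub_heegnerIndexLowerAtTwo` — «RUBIN'S TRIANGLE at 2»: a third PRODUCER for
# HARDEST (a) = S2′ (`PrintCf2RubinValueTwo.RubinValueFormulaAtTwoV11`, item 24034), assembled from
# (2)₂ explicit reciprocity for the elliptic-unit Selmer class, (3)₂ Rubin's cyclotomic-height identity for the
# SAME class, (5)₂ the 2-adic Gross–Zagier formula (Disegni 2017 Thm B, printed for every rational prime p and
# potentially ordinary reduction), and (4) generator-freeness of `log² / height` on the one-dimensional
# `Sel₂(W/ℚ) ⊗ ℚ₂`.  The Heegner-index factor `λ` (κ_W = λ·y_K) and the 2-adic height `h₂(y_K)` CANCEL.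

Scratch certificate of seat `sidea-stub_heegnerIndexLowerAtTwo-1-g16` (planner, stub-ideation; NOT a proposal — published as a
crux workfile and attached as evidence on stmt-BirchSwinnertonDyer-27851).  THEOREMS ONLY: a field identity (the triangle) and
valuation shadows over `ℤ`; no `sorry`, no definitions, no named facts; NOTHING is asserted about BSD, about the crux
`PrintCf2.SplitBadTwoLowerHalfOfFacts`, about the stub, or about S2′ — none of them is proved here.

Dictionary (BDP, Pacific J. Math. 260 (2012) 261–303, p. 262–263, recalling Rubin, Invent. Math. 107 (1992), eqs. (1)–(5)):
* `val`  = `Ω_p(ν*)⁻¹·𝓛_𝔭(ψ_W*)` — the Katz value OUTSIDE the range (the number S2′ is about); `v = v₂ val`, `m = 2v`;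
* `logy` = `log_ω(y_K)` for the Heegner point `y_K ∈ W(K)` of the stub's frame; `ℓK = v₂ logy = ι + ℓ` (`ι` = 2-adic
  valuation of the index of `ℤ·P_gen` in `ℤ·y_K + tors`, `ℓ` = log-depth of the ℚ-generator);
* `hy`   = `⟨y_K, y_K⟩_cyc` (canonical cyclotomic 2-adic height; `≠ 0` by Bertrand at 2, tree fact
  `bertrand_pairingSq_self_ne_zero_two_of_j_eq_neg3375`); `hK = v₂ hy`;
* `Lder` = `𝓛₂′(ψ_W)` (cyclotomic derivative at the in-range point, central value 0); `L1 = v₂ Lder`;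
* `LK`   = `𝓛₂(ψ_{W^K})` = in-range value on the twisted branch = `E_K·L^{alg}(W^K,1)`; `v₂ LK = eK + aK`;
* `lam`  = `λ` with `κ_W = λ·κ(y_K)` in `Sel₂(W/ℚ) ⊗ ℚ₂` (one-dimensional: rank 1 + `Finite Ш`, both in the stub frame);
* `E₂, Ω` — the (2)₂ constants (`(1−β2⁻¹)⁻¹`-type Euler factor = 1 here since ψ_W is ramified at 𝔭; Gauss sum; unit period);
  `E₃` — the (3)₂ constant; `C₅` — Disegni's constant `c_E/2 · ∏_{v∣2} Z_v°(1)⁻¹ · d_F · Q(f₁,f₂,1)` composed with GZ.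
-/

-- the summit namespace `Summit.BirchSwinnertonDyer.BirchSwinnertonDyer` repeats the problem name by design (D-0017)
set_option linter.dupNamespace false
set_option autoImplicit false

namespace Summit.BirchSwinnertonDyer.BirchSwinnertonDyer.Cruxes.SplitBadTwoLowerHalfOfFacts.StubIdeasK1G16

section Triangle

variable {F : Type*} [Field F]

/-- PLAN 1, the PRODUCER (exact algebra of Rubin's triangle).  From (2) `λ·log y = E₂·val·Ω`, (3) `λ²·h(y) = E₃·L′·val`,
(5) `L′·L_K = C₅·h(y)`, with `val ≠ 0` and `h(y) ≠ 0`:  `E₂²·Ω²·L_K·val = E₃·C₅·(log y)²` — S2′ with an EXPLICIT constant;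
`λ` (Heegner/elliptic-unit index) and `h(y)` (the 2-adic height) have cancelled, no main conjecture, no descent. -/
theorem val_mul_eq_of_rubinTriangle {val logy hy Lder LK lam E₂ E₃ C₅ Ω : F}
    (h2 : lam * logy = E₂ * val * Ω) (h3 : lam ^ 2 * hy = E₃ * Lder * val) (h5 : Lder * LK = C₅ * hy)
    (hval : val ≠ 0) (hhy : hy ≠ 0) :
    E₂ ^ 2 * Ω ^ 2 * LK * val = E₃ * C₅ * logy ^ 2 := by
  have eqA : (E₂ * val * Ω) ^ 2 * hy = E₃ * Lder * val * logy ^ 2 := by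
    calc (E₂ * val * Ω) ^ 2 * hy = (lam * logy) ^ 2 * hy := by rw [h2]
      _ = (lam ^ 2 * hy) * logy ^ 2 := by ring
      _ = E₃ * Lder * val * logy ^ 2 := by rw [h3]
  have eqB : (E₂ * val * Ω) ^ 2 * hy * LK = E₃ * (C₅ * hy) * val * logy ^ 2 := by
    calc (E₂ * val * Ω) ^ 2 * hy * LK = E₃ * Lder * val * logy ^ 2 * LK := by rw [eqA]
      _ = E₃ * (Lder * LK) * val * logy ^ 2 := by ring
      _ = E₃ * (C₅ * hy) * val * logy ^ 2 := by rw [h5]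
  have key : (val * hy) * (E₂ ^ 2 * Ω ^ 2 * LK * val) = (val * hy) * (E₃ * C₅ * logy ^ 2) := by
    calc (val * hy) * (E₂ ^ 2 * Ω ^ 2 * LK * val) = (E₂ * val * Ω) ^ 2 * hy * LK := by ring
      _ = E₃ * (C₅ * hy) * val * logy ^ 2 := eqB
      _ = (val * hy) * (E₃ * C₅ * logy ^ 2) := by ring
  exact mul_left_cancel₀ (mul_ne_zero hval hhy) key

/-- The honest DICHOTOMY without `val ≠ 0`: either the out-of-range value vanishes (then κ_W is torsion in Selmer by (2),
and S2′⁻ holds vacuously with `m = ∞`; inside arm M″ the containment T1 + S3c + `Finite Ш` exclude this case), or S2′ holds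
with the explicit constant. -/
theorem rubinTriangle_dichotomy {val logy hy Lder LK lam E₂ E₃ C₅ Ω : F}
    (h2 : lam * logy = E₂ * val * Ω) (h3 : lam ^ 2 * hy = E₃ * Lder * val) (h5 : Lder * LK = C₅ * hy)
    (hhy : hy ≠ 0) :
    val = 0 ∨ E₂ ^ 2 * Ω ^ 2 * LK * val = E₃ * C₅ * logy ^ 2 := by
  by_cases hval : val = 0
  · exact Or.inl hval
  · exact Or.inr (val_mul_eq_of_rubinTriangle h2 h3 h5 hval hhy)

/-- (4) GENERATOR-FREENESS: replacing the generator `x` by `κ = λ·x` multiplies `log²` and the height by the same `λ²`,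
so the ratio road never needs to know `λ` (no Heegner index, no elliptic-unit index, no Kolyvagin). -/
theorem ratio_generator_free (lam logx hx : F) :
    (lam * logx) ^ 2 * hx = (lam ^ 2 * hx) * logx ^ 2 := by
  ring

/-- If moreover the constants are units up to KEYED powers of 2 one may read S2′ multiplicatively: with `LK ≠ 0`, `E₂ ≠ 0`,
`Ω ≠ 0` the value is DETERMINED: `val = E₃·C₅·log²y / (E₂²·Ω²·L_K)`. -/
theorem val_eq_of_rubinTriangle {val logy hy Lder LK lam E₂ E₃ C₅ Ω : F}
    (h2 : lam * logy = E₂ * val * Ω) (h3 : lam ^ 2 * hy = E₃ * Lder * val) (h5 : Lder * LK = C₅ * hy)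
    (hval : val ≠ 0) (hhy : hy ≠ 0) (hE₂ : E₂ ≠ 0) (hΩ : Ω ≠ 0) (hLK : LK ≠ 0) :
    val = E₃ * C₅ * logy ^ 2 / (E₂ ^ 2 * Ω ^ 2 * LK) := by
  have h := val_mul_eq_of_rubinTriangle h2 h3 h5 hval hhy
  have hden : E₂ ^ 2 * Ω ^ 2 * LK ≠ 0 := mul_ne_zero (mul_ne_zero (pow_ne_zero 2 hE₂) (pow_ne_zero 2 hΩ)) hLK
  rw [eq_div_iff hden]
  calc val * (E₂ ^ 2 * Ω ^ 2 * LK) = E₂ ^ 2 * Ω ^ 2 * LK * val := by ring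
    _ = E₃ * C₅ * logy ^ 2 := h

end Triangle

section ValuationShadow

/-- PLAN 1 in valuation shadow (`m = 2v`, S2′'s `2^{-m/2}` convention): the three identities give
`2v = 4ℓK + C_an(key)` with `C_an = 2(e₃ + c₅ − eK − aK) − 4(e₂ + ω)` — EXACT S2′ in the Heegner-point currency. -/
theorem twoVal_eq_of_triangle {v ℓK hK L1 lam e₂ e₃ c₅ eK aK ω : ℤ}
    (h2 : lam + ℓK = e₂ + ω + v) (h3 : 2 * lam + hK = e₃ + L1 + v) (h5 : L1 + eK + aK = c₅ + hK) :
    2 * v = 4 * ℓK + (2 * (e₃ + c₅ - eK - aK) - 4 * (e₂ + ω)) := by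
  omega

/-- PLAN 3 (weakest sufficient form): the LOWER half S2′⁻ follows from ONE-SIDED halves — (2)^≤ «log κ_W is not more
2-divisible than E₂·Ω·val», (3)^≥ «the height of κ_W is at least as 2-divisible as E₃·L′·val», (5)^≥ «L′·L_K is divisible by
C₅·h(y_K)».  (The opposite halves give the UPPER half; see `twoVal_le_of_oneSided`.) -/
theorem twoVal_ge_of_oneSided {v ℓK hK L1 lam e₂ e₃ c₅ eK aK ω : ℤ}
    (h2le : lam + ℓK ≤ e₂ + ω + v) (h3ge : e₃ + L1 + v ≤ 2 * lam + hK) (h5ge : c₅ + hK ≤ L1 + eK + aK) :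
    4 * ℓK + (2 * (e₃ + c₅ - eK - aK) - 4 * (e₂ + ω)) ≤ 2 * v := by
  omega

/-- The UPPER half (not needed by the LOWER child; recorded to show which halves are load-bearing where). -/
theorem twoVal_le_of_oneSided {v ℓK hK L1 lam e₂ e₃ c₅ eK aK ω : ℤ}
    (h2ge : e₂ + ω + v ≤ lam + ℓK) (h3le : 2 * lam + hK ≤ e₃ + L1 + v) (h5le : L1 + eK + aK ≤ c₅ + hK) :
    2 * v ≤ 4 * ℓK + (2 * (e₃ + c₅ - eK - aK) - 4 * (e₂ + ω)) := by
  omega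

/-- B8-type sanity: with the WRONG pairing of halves ((2)^≥ with (3)^≥) nothing bounds `v` from below — witness. -/
theorem wrongHalves_do_not_bound :
    ∃ v ℓK hK L1 lam e₂ e₃ c₅ eK aK ω : ℤ,
      e₂ + ω + v ≤ lam + ℓK ∧ e₃ + L1 + v ≤ 2 * lam + hK ∧ c₅ + hK ≤ L1 + eK + aK ∧
      ¬ 4 * ℓK + (2 * (e₃ + c₅ - eK - aK) - 4 * (e₂ + ω)) ≤ 2 * v := by
  refine ⟨-1, 0, 0, 0, 0, 0, 0, 0, 0, 0, 0, ?_, ?_, ?_, ?_⟩ <;> norm_num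

/-- Conversion to the critic's S2′ currency (`m = 2(A + g) + eA`, `A = v₂ q = v₂ Ш_an(W)`, `g = v₂Tam − 2v₂tors + 2ℓ`):
Gross–Zagier in BSD shape over K (`2ι = A + A′ + τ`, `A′ = v₂ Ш_an(W^K)`) and the rank-zero BSD shape of the twisted branch
(`aK = A′ + τ′`) turn `2v = 4(ι + ℓ) + C_an` into the S2′ shape with an EXPLICIT `eA`; `A′` CANCELS (the rank-0 twist's Ш is
never needed). `t = v₂Tam(W) − 2v₂#W(ℚ)_tors` is the member's own digit, present on both sides of arm M″. -/
theorem s2shape_of_triangle_GZ {v ι ℓ A A' τ τ' t e₂ e₃ c₅ eK aK ω : ℤ}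
    (hTri : 2 * v = 4 * (ι + ℓ) + (2 * (e₃ + c₅ - eK - aK) - 4 * (e₂ + ω)))
    (hGZ : 2 * ι = A + A' + τ) (hK0 : aK = A' + τ') :
    2 * v = 2 * (A + (t + 2 * ℓ)) + (2 * τ - 2 * τ' + 2 * e₃ + 2 * c₅ - 2 * eK - 4 * e₂ - 4 * ω - 2 * t) := by
  omega

/-- END TO END inside arm M″ (STUB-PLAN v3.x, T3.6): triangle-S2′ (K-currency) + T1 containment at the member
(`m = 2v ≤ 2n + eM`) + S3c EXACT (`n = B + t + 2ℓ + eC`, tree theorem `restrictedControl_two_holds`) give the INDEX UPPER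
BOUND `4ι + C_an ≤ 2B + 2t + 2eC + eM` — the shape of `stub_heegnerIndexLowerAtTwo`'s conclusion
(`2v₂[index] − 2v₂c ≤ v₂#Ш[2^∞] + v₂Tam` over K) once the budget `C_an` versus `2eC + eM` is the keyed constant comparison. -/
theorem indexUpper_of_triangle_T1_S3c {v ι ℓ n B t eC eM Can : ℤ}
    (hS2 : 2 * v = 4 * (ι + ℓ) + Can) (hT1 : 2 * v ≤ 2 * n + eM) (hS3c : n = B + t + 2 * ℓ + eC) :
    4 * ι + Can ≤ 2 * B + 2 * t + 2 * eC + eM := by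
  omega

/-- The same with only the ONE-SIDED producer (PLAN 3): S2′⁻ `4(ι+ℓ) + C_an ≤ 2v` suffices for the index upper bound. -/
theorem indexUpper_of_oneSided_T1_S3c {v ι ℓ n B t eC eM Can : ℤ}
    (hS2lo : 4 * (ι + ℓ) + Can ≤ 2 * v) (hT1 : 2 * v ≤ 2 * n + eM) (hS3c : n = B + t + 2 * ℓ + eC) :
    4 * ι + Can ≤ 2 * B + 2 * t + 2 * eC + eM := by
  omega

/-- LOWER in the critic's letters from the triangle: `A ≤ B` as soon as the EXPLICIT analytic constant dominates the algebraic
budget, `2eC + eM ≤ eA` (anchor-free; cf. k1-g14 `lower_of_explicit`, here with `eA` PRODUCED, not posited). -/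
theorem lower_of_triangle_explicit {m A B g n eA eC eM : ℤ}
    (hS2 : m = 2 * (A + g) + eA) (hT1 : m ≤ 2 * n + eM) (hS3c : n = B + g + eC) (hbudget : 2 * eC + eM ≤ eA + 1) :
    A ≤ B := by
  omega

end ValuationShadow

end Summit.BirchSwinnertonDyer.BirchSwinnertonDyer.Cruxes.SplitBadTwoLowerHalfOfFacts.StubIdeasK1G16
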